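import Mathlib
import Literature.MathematicalPhysics.KineticTheory.EntropyProductionBounds
import Literature.MathematicalPhysics.KineticTheory.EntropyProductionScaling
import Literature.MathematicalPhysics.KineticTheory.HardSphereEulerProofs
import HarnessLib

/-!
# Normalisation of the regularised velocity clouds of `HardSphereEEP`

`Literature.MathematicalPhysics.KineticTheory.HardSphereEEP` (Villani 2003 = Rezakhanlou–Villani,
LNM 1916 (2008), Ch. 1 §1.4.2 Thm 4, special-cased to regularised laws of velocity clouds) is stated
with inline `let`s. This file names the objects appearing there —

* `cloudMean p v = Σ p_i v_i` (bulk velocity `ū`),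
* `cloudTemp p v h = Σ p_i |v_i - ū|²/3 + h²` (temperature `T`),
* `cloudLaw p v h δ = (1 - δ) Σ p_i M_{1,v_i,h²} + δ M_{1,ū,T}` (the regularised law `f̂`),
* `cloudLawNormalised p v h δ = (1 - δ) Σ p_i M_{1,(v_i-ū)/√T,(h/√T)²} + δ M_{1,0,1}` (its
  normalisation `f̃(x) = T^{3/2} f̂(ū + √T x)`),

records that `HardSphereEEP` is literally the statement about them (`hardSphereEEP_iff`), and
carries out Stage 0 of the published proof, the reduction to the normalised class
(Rezakhanlou–Villani 2008, Ch. 1 §1.4.2 "Normalization", pp. 23–24):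

* `entropyProduction_cloudLaw`: `D(f̂) = √T · D(f̃)` (hard spheres: `B̃(z,σ) = B(√T z, σ) = √T B`);
* `relEntropy_cloudLaw`: `H(f̂ | M_{1,ū,T}) = H(f̃ | M)`;
* `cloudLawNormalised_ge`: the Maxwellian lower bound `f̃ ≥ δ M = δ (2π)^{-3/2} e^{-|x|²/2}`
  (hypothesis `f ≥ ρ₀ e^{-A₀|v|^{q₀}}` of Thm 4 with `ρ₀ = δ(2π)^{-3/2}`, `A₀ = 1/2`, `q₀ = 2`);
* `sq_le_cloudTemp`, `cloudTemp_le`: `h² ≤ T ≤ 4R/(3λ) + h²` under `Σ p_i e^{λ|v_i|²} ≤ R`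
  (so the width `h/√T` of `f̃` ranges in a compact subinterval of `(0, 1]`);
* `integral_cloudLawNormalised`, `integral_cloudLawNormalised_smul`,
  `integral_cloudLawNormalised_mul_norm_sq`: `∫ f̃ = 1`, `∫ f̃ x dx = 0`, `∫ f̃ |x|² dx = 3`, i.e.
  `f̃ ∈ 𝒞(1,0,1)` (Rezakhanlou–Villani 2008, p. 23 (6)), via the Gaussian moments
  `∫ M_{1,c,θ} v = c`, `∫ M_{1,c,θ} |v|² = |c|² + 3θ`.

Nothing here is specific to dimension three except the ambient type `V3 = ℝ³` of `HardSphereEEP`.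
-/

namespace Literature.MathematicalPhysics.KineticTheory

open _root_.MeasureTheory Real Finset
open scoped InnerProductSpace BigOperators
open Literature.Analysis.FluidPDE (localMaxwellian entropyProduction)

noncomputable section

variable {n : ℕ}

/-- Bulk velocity `ū = Σ_i p_i v_i` of a weighted velocity cloud. [folklore] -/
def cloudMean (p : Fin n → ℝ) (v : Fin n → V3) : V3 :=
  ∑ l, p l • v l

/-- Temperature `T = Σ_i p_i |v_i - ū|² / 3 + h²` of the regularised law of a weighted velocity
cloud (one third of the energy per unit mass in the frame of `ū`, the mollifier contributing `h²`).
[folklore] -/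
def cloudTemp (p : Fin n → ℝ) (v : Fin n → V3) (h : ℝ) : ℝ :=
  (∑ i, p i * ‖v i - cloudMean p v‖ ^ 2) / 3 + h ^ 2

/-- The regularised law of a weighted velocity cloud,
`f̂ = (1 - δ) Σ_i p_i M_{1,v_i,h²} + δ M_{1,ū,T}`: the empirical measure mollified by the Gaussian
`G_h = M_{1,·,h²}` and mixed with the Maxwellian of the same mass, momentum and energy
(the object of `HardSphereEEP`). [folklore] -/
def cloudLaw (p : Fin n → ℝ) (v : Fin n → V3) (h δ : ℝ) (w : V3) : ℝ :=
  (1 - δ) * (∑ i, p i * localMaxwellian 1 (h ^ 2) (v i) w) +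
    δ * localMaxwellian 1 (cloudTemp p v h) (cloudMean p v) w

/-- The normalised law `f̃(x) = T^{3/2} f̂(ū + √T x)` of a weighted velocity cloud, written as a
cloud: centres `(v_i - ū)/√T`, width `h/√T`, Maxwellian part the standard Maxwellian `M_{1,0,1}`
(Rezakhanlou–Villani 2008, p. 23: `f̃ ∈ 𝒞(1,0,1)`). [folklore] -/
def cloudLawNormalised (p : Fin n → ℝ) (v : Fin n → V3) (h δ : ℝ) (x : V3) : ℝ :=
  (1 - δ) * (∑ i, p i *
      localMaxwellian 1 ((h / Real.sqrt (cloudTemp p v h)) ^ 2)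
        ((Real.sqrt (cloudTemp p v h))⁻¹ • (v i - cloudMean p v)) x) +
    δ * localMaxwellian 1 1 0 x

/-- `HardSphereEEP` is, verbatim, the entropy–entropy-production inequality
`K · H(f̂ | M_{1,ū,T})^{1+ε} ≤ D(f̂)` for the regularised cloud laws `f̂ = cloudLaw p v h δ`.
[folklore] -/
theorem hardSphereEEP_iff :
    HardSphereEEP ↔
      ∀ (ε h δ lam R : ℝ), 0 < ε → 0 < h → h ≤ 1 → 0 < δ → δ < 1 → 0 < lam →
        ∃ K : ℝ, 0 < K ∧ ∀ (n : ℕ) (p : Fin n → ℝ) (v : Fin n → V3),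
          (∀ i, 0 ≤ p i) → ∑ i, p i = 1 → ∑ i, p i * Real.exp (lam * ‖v i‖ ^ 2) ≤ R →
            K * (∫ w, cloudLaw p v h δ w *
                log (cloudLaw p v h δ w /
                  localMaxwellian 1 (cloudTemp p v h) (cloudMean p v) w)) ^ (1 + ε) ≤
              entropyProduction hardSphereKernel (cloudLaw p v h δ) :=
  Iff.rfl

/-! ## Temperature bounds -/

/-- `T ≥ h²`. [folklore] -/
theorem sq_le_cloudTemp (p : Fin n → ℝ) (v : Fin n → V3) (h : ℝ) (hp : ∀ i, 0 ≤ p i) :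
    h ^ 2 ≤ cloudTemp p v h := by
  unfold cloudTemp
  have : 0 ≤ ∑ i, p i * ‖v i - cloudMean p v‖ ^ 2 :=
    sum_nonneg fun i _ => mul_nonneg (hp i) (sq_nonneg _)
  linarith

/-- `T > 0` as soon as `h ≠ 0`. [folklore] -/
theorem cloudTemp_pos (p : Fin n → ℝ) (v : Fin n → V3) {h : ℝ} (hh : h ≠ 0)
    (hp : ∀ i, 0 ≤ p i) : 0 < cloudTemp p v h :=
  lt_of_lt_of_le (by positivity) (sq_le_cloudTemp p v h hp)

/-- Jensen for the squared norm of a convex combination: `|Σ p_i v_i|² ≤ Σ p_i |v_i|²`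
(`p_i ≥ 0`, `Σ p_i = 1`). [folklore] -/
theorem norm_sq_cloudMean_le (p : Fin n → ℝ) (v : Fin n → V3) (hp : ∀ i, 0 ≤ p i)
    (hp1 : ∑ i, p i = 1) : ‖cloudMean p v‖ ^ 2 ≤ ∑ i, p i * ‖v i‖ ^ 2 := by
  unfold cloudMean
  have h1 : ‖∑ l, p l • v l‖ ≤ ∑ l, p l * ‖v l‖ := by
    refine (norm_sum_le _ _).trans (le_of_eq (sum_congr rfl fun l _ => ?_))
    rw [norm_smul, Real.norm_eq_abs, abs_of_nonneg (hp l)]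
  -- Cauchy–Schwarz: (Σ p‖v‖)² = (Σ √p · √p‖v‖)² ≤ (Σ p) (Σ p ‖v‖²)
  have h2 : (∑ l, p l * ‖v l‖) ^ 2 ≤ (∑ l, p l) * ∑ l, p l * ‖v l‖ ^ 2 := by
    have := sum_mul_sq_le_sq_mul_sq univ (fun l => Real.sqrt (p l))
      (fun l => Real.sqrt (p l) * ‖v l‖)
    have e1 : ∀ l, Real.sqrt (p l) * (Real.sqrt (p l) * ‖v l‖) = p l * ‖v l‖ := fun l => by
      rw [← mul_assoc, Real.mul_self_sqrt (hp l)]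
    have e2 : ∀ l, Real.sqrt (p l) ^ 2 = p l := fun l => Real.sq_sqrt (hp l)
    have e3 : ∀ l, (Real.sqrt (p l) * ‖v l‖) ^ 2 = p l * ‖v l‖ ^ 2 := fun l => by
      rw [mul_pow, Real.sq_sqrt (hp l)]
    simpa only [e1, e2, e3] using this
  rw [hp1, one_mul] at h2
  calc ‖∑ l, p l • v l‖ ^ 2 ≤ (∑ l, p l * ‖v l‖) ^ 2 := by
        gcongr
    _ ≤ _ := h2

/-- `T ≤ 4R/(3λ) + h²` under the Gaussian moment bound `Σ p_i e^{λ|v_i|²} ≤ R`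
(`|v_i - ū|² ≤ 2|v_i|² + 2|ū|²`, Jensen, and `λ t ≤ e^{λ t}`). [folklore] -/
theorem cloudTemp_le (p : Fin n → ℝ) (v : Fin n → V3) (h : ℝ) {lam R : ℝ} (hlam : 0 < lam)
    (hp : ∀ i, 0 ≤ p i) (hp1 : ∑ i, p i = 1)
    (hR : ∑ i, p i * Real.exp (lam * ‖v i‖ ^ 2) ≤ R) :
    cloudTemp p v h ≤ 4 * R / (3 * lam) + h ^ 2 := by
  have hmom : ∑ i, p i * ‖v i‖ ^ 2 ≤ R / lam := by
    rw [le_div_iff₀ hlam, sum_mul]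
    refine le_trans (sum_le_sum fun i _ => ?_) hR
    rw [mul_assoc]
    refine mul_le_mul_of_nonneg_left ?_ (hp i)
    rw [mul_comm]
    exact le_trans (by linarith) (Real.add_one_le_exp (lam * ‖v i‖ ^ 2))
  have hvar : ∑ i, p i * ‖v i - cloudMean p v‖ ^ 2 ≤ 4 * (R / lam) := by
    have hterm : ∀ i, p i * ‖v i - cloudMean p v‖ ^ 2 ≤
        p i * (2 * ‖v i‖ ^ 2 + 2 * ‖cloudMean p v‖ ^ 2) := fun i => by
      refine mul_le_mul_of_nonneg_left ?_ (hp i)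
      have h1 : ‖v i - cloudMean p v‖ ^ 2 ≤ (‖v i‖ + ‖cloudMean p v‖) ^ 2 := by
        gcongr
        exact norm_sub_le (v i) (cloudMean p v)
      nlinarith [sq_nonneg (‖v i‖ - ‖cloudMean p v‖)]
    calc ∑ i, p i * ‖v i - cloudMean p v‖ ^ 2
        ≤ ∑ i, p i * (2 * ‖v i‖ ^ 2 + 2 * ‖cloudMean p v‖ ^ 2) := sum_le_sum fun i _ => hterm i
      _ = 2 * ∑ i, p i * ‖v i‖ ^ 2 + 2 * ‖cloudMean p v‖ ^ 2 * ∑ i, p i := by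
          rw [mul_sum, mul_sum, ← sum_add_distrib]
          refine sum_congr rfl fun i _ => ?_
          ring
      _ ≤ 2 * (R / lam) + 2 * (R / lam) * 1 := by
          rw [hp1]
          have := norm_sq_cloudMean_le p v hp hp1
          nlinarith
      _ = 4 * (R / lam) := by ring
  unfold cloudTemp
  rw [div_add' _ _ _ (by positivity : (3 * lam) ≠ 0), le_div_iff₀ (by positivity)]
  have : (∑ i, p i * ‖v i - cloudMean p v‖ ^ 2) / 3 * (3 * lam) =
      lam * ∑ i, p i * ‖v i - cloudMean p v‖ ^ 2 := by ring
  rw [add_mul, this]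
  have h4 : lam * ∑ i, p i * ‖v i - cloudMean p v‖ ^ 2 ≤ 4 * R := by
    calc lam * ∑ i, p i * ‖v i - cloudMean p v‖ ^ 2 ≤ lam * (4 * (R / lam)) := by gcongr
      _ = 4 * R := by field_simp
  nlinarith [h4]

/-! ## Lower bound -/

/-- The Gaussian-mixture part of a cloud law is nonnegative. [folklore] -/
theorem cloudMixture_nonneg (p : Fin n → ℝ) (hp : ∀ i, 0 ≤ p i) (θ : ℝ) (hθ : 0 ≤ θ)
    (c : Fin n → V3) (x : V3) : 0 ≤ ∑ i, p i * localMaxwellian 1 θ (c i) x :=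
  sum_nonneg fun i _ => mul_nonneg (hp i) (localMaxwellian_nonneg zero_le_one hθ _ _)

/-- **Maxwellian lower bound for the normalised cloud law**: `f̃ ≥ δ M_{1,0,1}`, i.e.
`f̃(x) ≥ δ (2π)^{-3/2} e^{-|x|²/2}` — hypothesis `f ≥ ρ₀ e^{-A₀ |v|^{q₀}}` of Rezakhanlou–Villani 2008
Ch. 1 Thm 4 with `ρ₀ = δ (2π)^{-3/2}`, `A₀ = 1/2`, `q₀ = 2`, uniformly in the cloud. [folklore] -/
theorem cloudLawNormalised_ge (p : Fin n → ℝ) (v : Fin n → V3) (h : ℝ) {δ : ℝ} (hδ : δ ≤ 1)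
    (hp : ∀ i, 0 ≤ p i) (x : V3) :
    δ * localMaxwellian 1 1 0 x ≤ cloudLawNormalised p v h δ x := by
  unfold cloudLawNormalised
  have := cloudMixture_nonneg p hp ((h / Real.sqrt (cloudTemp p v h)) ^ 2) (sq_nonneg _)
    (fun i => (Real.sqrt (cloudTemp p v h))⁻¹ • (v i - cloudMean p v)) x
  nlinarith

/-- The normalised cloud law is everywhere positive (`0 < δ ≤ 1`). [folklore] -/
theorem cloudLawNormalised_pos (p : Fin n → ℝ) (v : Fin n → V3) (h : ℝ) {δ : ℝ} (hδ0 : 0 < δ)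
    (hδ : δ ≤ 1) (hp : ∀ i, 0 ≤ p i) (x : V3) : 0 < cloudLawNormalised p v h δ x :=
  lt_of_lt_of_le (mul_pos hδ0 (localMaxwellian_pos one_pos one_pos _ _))
    (cloudLawNormalised_ge p v h hδ hp x)

/-- The cloud law is everywhere positive (`h ≠ 0`, `0 < δ ≤ 1`). [folklore] -/
theorem cloudLaw_pos (p : Fin n → ℝ) (v : Fin n → V3) {h δ : ℝ} (hh : h ≠ 0) (hδ0 : 0 < δ)
    (hδ : δ ≤ 1) (hp : ∀ i, 0 ≤ p i) (w : V3) : 0 < cloudLaw p v h δ w := by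
  unfold cloudLaw
  have h1 := cloudMixture_nonneg p hp (h ^ 2) (sq_nonneg _) v w
  have h2 := localMaxwellian_pos one_pos (cloudTemp_pos p v hh hp) (cloudMean p v) w
  nlinarith

/-! ## Moments: the normalised cloud law lies in `𝒞(1,0,1)` -/

section Moments

open ProbabilityTheory

/-- Integrability against a local Maxwellian density is integrability against the Gaussian law
`gaussMeasure c θ` (`θ > 0`). [folklore] -/
theorem integrable_localMaxwellian_smul_iff {F : Type*} [NormedAddCommGroup F] [NormedSpace ℝ F]
    {θ : ℝ} (hθ : 0 < θ) (c : V3) (g : V3 → F) :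
    Integrable (fun v => localMaxwellian 1 θ c v • g v) ↔ Integrable g (gaussMeasure c θ) := by
  rw [← withDensity_localMaxwellian_eq_gaussMeasure hθ c,
    integrable_withDensity_iff_integrable_smul'
      (continuous_localMaxwellian 1 θ c).measurable.ennreal_ofReal
      (Filter.Eventually.of_forall fun _ => ENNReal.ofReal_lt_top)]
  simp_rw [ENNReal.toReal_ofReal (localMaxwellian_nonneg zero_le_one hθ.le _ _)]

/-- `v ↦ M_{1,c,θ}(v) v` is integrable (`θ > 0`). [folklore] -/
theorem integrable_localMaxwellian_smul_id {θ : ℝ} (hθ : 0 < θ) (c : V3) :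
    Integrable (fun v => localMaxwellian 1 θ c v • v) :=
  (integrable_localMaxwellian_smul_iff hθ c id).2 IsGaussian.integrable_id

/-- `v ↦ M_{1,c,θ}(v) |v|²` is integrable (`θ > 0`). [folklore] -/
theorem integrable_localMaxwellian_mul_norm_sq {θ : ℝ} (hθ : 0 < θ) (c : V3) :
    Integrable (fun v => localMaxwellian 1 θ c v * ‖v‖ ^ 2) :=
  (integrable_localMaxwellian_smul_iff hθ c (fun v => ‖v‖ ^ 2)).2
    ((IsGaussian.memLp_id _ 2 (by simp)).integrable_norm_pow (by norm_num))

/-- Mean of a Gaussian: `∫ M_{1,c,θ}(v) v dv = c` (`θ > 0`). [folklore] -/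
theorem integral_localMaxwellian_smul_id {θ : ℝ} (hθ : 0 < θ) (c : V3) :
    ∫ v, localMaxwellian 1 θ c v • v = c := by
  have hI : Integrable (fun w : V3 => Real.sqrt θ • w) (stdGaussian V3) :=
    IsGaussian.integrable_fun_id.smul (Real.sqrt θ)
  rw [integral_localMaxwellian_smul hθ c (fun v => v), integral_add (integrable_const c) hI,
    integral_smul, integral_id_stdGaussian, smul_zero, add_zero, integral_const, probReal_univ,
    one_smul]

/-- Energy of a Gaussian: `∫ M_{1,c,θ}(v) |v|² dv = |c|² + 3θ` on `ℝ³` (`θ > 0`). [folklore] -/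
theorem integral_localMaxwellian_mul_norm_sq {θ : ℝ} (hθ : 0 < θ) (c : V3) :
    ∫ v, localMaxwellian 1 θ c v * ‖v‖ ^ 2 = ‖c‖ ^ 2 + 3 * θ := by
  have h := integral_localMaxwellian_smul hθ c (fun v => ‖v‖ ^ 2)
  simp only [smul_eq_mul] at h
  rw [h]
  have hexp : ∀ w : V3, ‖c + Real.sqrt θ • w‖ ^ 2 =
      ‖c‖ ^ 2 + 2 * Real.sqrt θ * ⟪c, w⟫_ℝ + θ * ‖w‖ ^ 2 := by
    intro w
    rw [norm_add_sq_real, real_inner_smul_right, norm_smul, Real.norm_eq_abs,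
      abs_of_nonneg (Real.sqrt_nonneg θ), mul_pow, Real.sq_sqrt hθ.le]
    ring
  simp_rw [hexp]
  have hA : Integrable (fun _ : V3 => ‖c‖ ^ 2) (stdGaussian V3) := integrable_const _
  have hB : Integrable (fun w : V3 => 2 * Real.sqrt θ * ⟪c, w⟫_ℝ) (stdGaussian V3) :=
    (IsGaussian.integrable_fun_id.const_inner c).const_mul _
  have hC : Integrable (fun w : V3 => θ * ‖w‖ ^ 2) (stdGaussian V3) :=
    integrable_norm_sq_stdGaussian.const_mul θ
  have hAB : Integrable (fun w : V3 => ‖c‖ ^ 2 + 2 * Real.sqrt θ * ⟪c, w⟫_ℝ) (stdGaussian V3) :=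
    hA.add hB
  rw [integral_add hAB hC, integral_add hA hB, integral_const, integral_const_mul,
    integral_const_mul, integral_inner IsGaussian.integrable_fun_id c, integral_id_stdGaussian,
    integral_norm_sq_stdGaussian, probReal_univ, Fintype.card_fin]
  simp only [one_smul, inner_zero_right, mul_zero, add_zero]
  push_cast
  ring

variable (p : Fin n → ℝ) (v : Fin n → V3) {h : ℝ}

/-- The squared width `(h/√T)²` of the normalised cloud is positive (`h ≠ 0`). [folklore] -/
theorem cloudWidth_sq_pos (hh : h ≠ 0) (hp : ∀ i, 0 ≤ p i) :
    0 < (h / Real.sqrt (cloudTemp p v h)) ^ 2 := by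
  have := Real.sqrt_pos.2 (cloudTemp_pos p v hh hp)
  positivity

/-- **Unit mass**: `∫ f̃ = 1` (`Σ p_i = 1`). [folklore] -/
theorem integral_cloudLawNormalised (hh : h ≠ 0) (δ : ℝ) (hp : ∀ i, 0 ≤ p i)
    (hp1 : ∑ i, p i = 1) : ∫ x, cloudLawNormalised p v h δ x = 1 := by
  have hσ := cloudWidth_sq_pos p v hh hp
  set σ2 := (h / Real.sqrt (cloudTemp p v h)) ^ 2 with hσ2
  set c : Fin n → V3 := fun i => (Real.sqrt (cloudTemp p v h))⁻¹ • (v i - cloudMean p v) with hc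
  have hint : ∀ i, Integrable (fun x : V3 => p i * localMaxwellian 1 σ2 (c i) x) := fun i =>
    (integrable_localMaxwellian hσ (c i)).const_mul _
  unfold cloudLawNormalised
  rw [integral_add ((integrable_finsetSum _ fun i _ => hint i).const_mul _)
      ((integrable_localMaxwellian one_pos 0).const_mul _),
    integral_const_mul, integral_const_mul, integral_finsetSum _ fun i _ => hint i,
    integral_localMaxwellian_one one_pos]
  simp_rw [integral_const_mul, integral_localMaxwellian_one hσ, mul_one, hp1]
  ring

/-- **Zero momentum**: `∫ f̃(x) x dx = 0` (`Σ p_i = 1`, `ū = Σ p_i v_i`). [folklore] -/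
theorem integral_cloudLawNormalised_smul (hh : h ≠ 0) (δ : ℝ) (hp : ∀ i, 0 ≤ p i)
    (hp1 : ∑ i, p i = 1) : ∫ x, cloudLawNormalised p v h δ x • x = 0 := by
  have hσ := cloudWidth_sq_pos p v hh hp
  set a := Real.sqrt (cloudTemp p v h) with ha
  set σ2 := (h / a) ^ 2 with hσ2
  set c : Fin n → V3 := fun i => a⁻¹ • (v i - cloudMean p v) with hc
  have hint : ∀ i, Integrable (fun x : V3 => p i • (localMaxwellian 1 σ2 (c i) x • x)) := fun i =>
    (integrable_localMaxwellian_smul_id hσ (c i)).smul (p i)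
  have hexp : ∀ x : V3, cloudLawNormalised p v h δ x • x =
      (1 - δ) • (∑ i, p i • (localMaxwellian 1 σ2 (c i) x • x)) +
        δ • (localMaxwellian 1 1 0 x • x) := by
    intro x
    simp only [cloudLawNormalised, add_smul, mul_smul, Finset.sum_smul]
    rfl
  simp_rw [hexp]
  have hS : Integrable (fun x : V3 => (1 - δ) • ∑ i, p i • (localMaxwellian 1 σ2 (c i) x • x)) :=
    (integrable_finsetSum _ fun i _ => hint i).smul (1 - δ)
  have hM : Integrable (fun x : V3 => δ • (localMaxwellian 1 1 0 x • x)) :=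
    (integrable_localMaxwellian_smul_id one_pos 0).smul δ
  rw [integral_add hS hM, integral_smul, integral_smul, integral_finsetSum _ fun i _ => hint i,
    integral_localMaxwellian_smul_id one_pos, smul_zero, add_zero]
  simp_rw [integral_smul, integral_localMaxwellian_smul_id hσ, hc, smul_smul, mul_comm _ a⁻¹,
    ← smul_smul, ← Finset.smul_sum, smul_sub, Finset.sum_sub_distrib, ← Finset.sum_smul, hp1,
    one_smul]
  rw [show ∑ i, p i • v i = cloudMean p v from rfl, sub_self, smul_zero, smul_zero]

/-- **Unit temperature**: `∫ f̃(x) |x|² dx = 3` (`Σ p_i = 1`, `T = Σ p_i|v_i - ū|²/3 + h²`):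
`(1-δ)[Σ p_i |v_i-ū|²/T + 3h²/T] + 3δ = (1-δ)·3 + 3δ`. [folklore] -/
theorem integral_cloudLawNormalised_mul_norm_sq (hh : h ≠ 0) (δ : ℝ) (hp : ∀ i, 0 ≤ p i)
    (hp1 : ∑ i, p i = 1) : ∫ x, cloudLawNormalised p v h δ x * ‖x‖ ^ 2 = 3 := by
  have hT := cloudTemp_pos p v hh hp
  have hσ := cloudWidth_sq_pos p v hh hp
  set a := Real.sqrt (cloudTemp p v h) with ha
  have ha0 : 0 < a := Real.sqrt_pos.2 hT
  have ha2 : a ^ 2 = cloudTemp p v h := Real.sq_sqrt hT.le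
  set σ2 := (h / a) ^ 2 with hσ2
  set c : Fin n → V3 := fun i => a⁻¹ • (v i - cloudMean p v) with hc
  have hint : ∀ i, Integrable (fun x : V3 => p i * (localMaxwellian 1 σ2 (c i) x * ‖x‖ ^ 2)) :=
    fun i => (integrable_localMaxwellian_mul_norm_sq hσ (c i)).const_mul _
  have hexp : ∀ x : V3, cloudLawNormalised p v h δ x * ‖x‖ ^ 2 =
      (1 - δ) * (∑ i, p i * (localMaxwellian 1 σ2 (c i) x * ‖x‖ ^ 2)) +
        δ * (localMaxwellian 1 1 0 x * ‖x‖ ^ 2) := by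
    intro x
    simp only [cloudLawNormalised, add_mul, mul_assoc, Finset.sum_mul]
    rfl
  simp_rw [hexp]
  rw [integral_add ((integrable_finsetSum _ fun i _ => hint i).const_mul _)
      ((integrable_localMaxwellian_mul_norm_sq one_pos 0).const_mul _),
    integral_const_mul, integral_const_mul, integral_finsetSum _ fun i _ => hint i,
    integral_localMaxwellian_mul_norm_sq one_pos, norm_zero]
  simp_rw [integral_const_mul, integral_localMaxwellian_mul_norm_sq hσ]
  -- Σ p_i (|c_i|² + 3σ²) = (Σ p_i |v_i - ū|²)/a² + 3 h²/a² = 3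
  have hci : ∀ i, ‖c i‖ ^ 2 = (a ^ 2)⁻¹ * ‖v i - cloudMean p v‖ ^ 2 := fun i => by
    simp only [hc, norm_smul, norm_inv, Real.norm_eq_abs, abs_of_pos ha0, mul_pow, inv_pow]
  simp_rw [hci, mul_add, Finset.sum_add_distrib, ← Finset.sum_mul, hp1, one_mul, ← mul_assoc,
    mul_comm (p _) (a ^ 2)⁻¹, mul_assoc, ← Finset.mul_sum]
  have hsum : ∑ i, p i * ‖v i - cloudMean p v‖ ^ 2 = 3 * (cloudTemp p v h - h ^ 2) := by
    unfold cloudTemp; ring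
  rw [hsum, hσ2, div_pow, ha2]
  field_simp
  ring

end Moments

/-! ## Normalisation (Rezakhanlou–Villani 2008, Ch. 1 §1.4.2, pp. 23–24) -/

/-- `f̃(x) = T^{3/2} f̂(ū + √T x)` (with `T^{3/2} = (√T)^{dim V3}`). [folklore] -/
theorem cloudLawNormalised_eq (p : Fin n → ℝ) (v : Fin n → V3) {h : ℝ} (hh : h ≠ 0) (δ : ℝ)
    (hp : ∀ i, 0 ≤ p i) (x : V3) :
    cloudLawNormalised p v h δ x =
      Real.sqrt (cloudTemp p v h) ^ Module.finrank ℝ V3 *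
        cloudLaw p v h δ (cloudMean p v + Real.sqrt (cloudTemp p v h) • x) := by
  have hT := cloudTemp_pos p v hh hp
  have ha : 0 < Real.sqrt (cloudTemp p v h) := Real.sqrt_pos.2 hT
  unfold cloudLawNormalised cloudLaw
  rw [cloud_affine p v (cloudMean p v) δ h hT.le ha x, Real.sq_sqrt hT.le, div_self hT.ne']

/-- **`D(f̂) = √T · D(f̃)`** for the hard-sphere entropy production (Rezakhanlou–Villani 2008,
p. 24: `D(f) = ρ² D̃(f̃)`, `B̃(z,σ) = B(√T z,σ) = √T |z|`, `ρ = 1`).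
[cite: RezakhanlouVillani2008, Ch. 1 §1.4.2 p. 24] -/
theorem entropyProduction_cloudLaw (p : Fin n → ℝ) (v : Fin n → V3) {h : ℝ} (hh : h ≠ 0)
    (δ : ℝ) (hp : ∀ i, 0 ≤ p i) :
    entropyProduction hardSphereKernel (cloudLaw p v h δ) =
      Real.sqrt (cloudTemp p v h) * entropyProduction hardSphereKernel
        (cloudLawNormalised p v h δ) := by
  have ha : 0 < Real.sqrt (cloudTemp p v h) := Real.sqrt_pos.2 (cloudTemp_pos p v hh hp)
  rw [entropyProduction_hardSphereKernel_affine (cloudLaw p v h δ) (cloudMean p v) ha]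
  congr 2
  funext x
  exact (cloudLawNormalised_eq p v hh δ hp x).symm

/-- **`H(f̂ | M_{1,ū,T}) = H(f̃ | M_{1,0,1})`** (Rezakhanlou–Villani 2008, p. 24:
`H(f | M^f) = ρ H(f̃ | M)`, `ρ = 1`). [cite: RezakhanlouVillani2008, Ch. 1 §1.4.2 p. 24] -/
theorem relEntropy_cloudLaw (p : Fin n → ℝ) (v : Fin n → V3) {h : ℝ} (hh : h ≠ 0) (δ : ℝ)
    (hp : ∀ i, 0 ≤ p i) :
    ∫ w, cloudLaw p v h δ w *
        log (cloudLaw p v h δ w / localMaxwellian 1 (cloudTemp p v h) (cloudMean p v) w) =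
      ∫ x, cloudLawNormalised p v h δ x *
        log (cloudLawNormalised p v h δ x / localMaxwellian 1 1 0 x) := by
  have hT := cloudTemp_pos p v hh hp
  have ha : 0 < Real.sqrt (cloudTemp p v h) := Real.sqrt_pos.2 hT
  have := integral_mul_log_div_localMaxwellian_affine (cloudLaw p v h δ) zero_le_one
    (cloudMean p v) ha
  rw [mul_one, Real.sq_sqrt hT.le] at this
  rw [← this]
  refine integral_congr_ae (Filter.Eventually.of_forall fun x => ?_)
  simp only [cloudLawNormalised_eq p v hh δ hp x]

end

end Literature.MathematicalPhysics.KineticTheory
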